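import Summits.NavierStokesRegularity.TurbBounds.Results.N1primeTail
import Summits.NavierStokesRegularity.TurbBounds.RBSpectralLink
import Summits.NavierStokesRegularity.TurbBounds.RBProfileValue
import HarnessLib

/-!
# Row RB-N1′ from the CITED reduction ALONE: `SpectralReduction Nu → Nu(10⁴) ≤ 871753553815459157/273640575184404480 ≤ 3.1857613`,
# and the spectral constraint (A1) for the certified degree-6 background, unconditional
(cell `pub-turb` / `turb-bounds`, v2 lane; composition file — needs pub-turb-sos's staged `SpectralForm.lean` (the cited statement) in the tree,
gen 6's `RBSpectralLink` / `RBProfileValue` and this seat's `Results/N1primeTail`. Written by pub-turb-cert, prover-pub-turb-cert-g7-0.)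

HONEST FRAMING: rigorous bounds for the stated PDE and boundary conditions; no claim about physical turbulence beyond the bound.
RESULT: `N1prime.spectralConstraint_holds : SpectralConstraint 10000 (435637/262144) tau'` — for the background `τ′(z) = −1 + φ(2z−1)/s`,
`φ = Σ_{p=1}^{6} φ̂_p P_p` with the CERTIFIED profile data `φ̂ = (0, −69900561/2²⁴, 0, −84023/2¹⁷, 0, 2563239/2²¹)`, `s = 435637/2¹⁸`, at `Ra = 10⁴`,
the full-gap mode form `Q_k[w, θ]` of the affine background method is `≥ 0` for EVERY `k > 0` on the two-sided no-slip class — UNCONDITIONAL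
(59 certified blocks + interval lemmas + evaluator + tail lemma + density + cutoff, all kernel-checked); `N1prime.nusselt_bound_of_spectralReduction
(h : SpectralReduction Nu) : Nu 10000 ≤ 871753553815459157/273640575184404480` (`…_decimal`: `≤ 3.1857613`) — CERTIFIED.md row RB-N1′ ('Ra = 10⁴,
every Pr, every horizontal period / lattice, d = 2, 3') from ONE hypothesis which is the published reduction stated verbatim ([cite: DingKerswell2019,
(13)–(16)] in mode form); the value `s∫τ′² − (s−1) = 1 + Σ_p φ̂_p²/((2p+1)s)` is gen 6's `RBProfile.rb_bound_value`.
NOT CLAIMED: the PDE energy argument (A1) ⇒ Nusselt bound (that IS the hypothesis); nothing about other Ra.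
-/

set_option linter.style.longLine false

noncomputable section

namespace Summit.NavierStokesRegularity.TurbBounds.Results.N1prime

open MeasureTheory intervalIntegral Finset Polynomial
open Summit.NavierStokesRegularity.TurbBounds.SpectralForm
open Summit.NavierStokesRegularity.TurbBounds.TailTwoSided (RBPositivity)
open Summit.NavierStokesRegularity.TurbBounds.RBSpectralLink (spectralConstraint_of_rbPositivity)
open Summit.NavierStokesRegularity.TurbBounds.RBProfile (phiPoly tauRB tauRB_continuous tauRB_total rb_bound_value)
open Summit.NavierStokesRegularity.TurbBounds.Certs.N1prime.Evaluator (Ra a0 s ghat0 ghat1 ghat2 ghat3 ghat4 ghat5 ghat6)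
open Literature.Analysis.SpecialFunctions (legendre legendre_zero)

/-- The certified Legendre shape data `φ̂_p` of the background as a real sequence (`φ̂₀ = 0`; `φ̂_p = ĝ_p` for `1 ≤ p ≤ 6`; zero beyond). -/
def phiR : ℕ → ℝ
  | 1 => ghat1 | 2 => ghat2 | 3 => ghat3 | 4 => ghat4 | 5 => ghat5 | 6 => ghat6 | _ => 0

/-- The row's background gradient `τ′(z) = −1 + φ(2z−1)/s` on `[0, 1]`, `s = 435637/262144`. -/
def tau' : ℝ → ℝ := tauRB ((435637 : ℝ) / 262144) 6 phiR

/-- `s` of the evaluator over `ℝ`. -/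
theorem s_real : ((s : ℚ) : ℝ) = (435637 : ℝ) / 262144 := by norm_num [s]

/-- The coupling profile of the certificate IS `s·τ′((y+1)/2)`: `Σ_{p≤6} ĝ_p P_p(y) = −s + φ(y)`. -/
theorem gp_eq_profile (y : ℝ) : TailN1prime.gp.eval y = ((435637 : ℝ) / 262144) * tau' ((y + 1) / 2) := by
  have e : 2 * ((y + 1) / 2) - 1 = y := by ring
  unfold tau' tauRB
  rw [e]
  unfold TailN1prime.gp phiPoly
  simp only [sum_range_succ, sum_range_zero, zero_add, TailN1prime.ghatR, phiR, eval_add, eval_mul, eval_C,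
    legendre_zero, eval_one]
  have h0 : ((ghat0 : ℚ) : ℝ) = -((435637 : ℝ) / 262144) := by
    rw [show ghat0 = -s from rfl]; push_cast; rw [s_real]
  rw [h0]
  field_simp
  ring

/-- **(A1) for row RB-N1′, unconditional.** -/
theorem spectralConstraint_holds : SpectralConstraint 10000 ((435637 : ℝ) / 262144) tau' := by
  apply spectralConstraint_of_rbPositivity
  have h := TailN1prime.rbPositivity_holds
  have ea : ((a0 : ℚ) : ℝ) = ((435637 : ℝ) / 262144 - 1) / 10000 := by norm_num [a0, s, Ra]
  have eg : (fun x : ℝ => TailN1prime.gp.eval x) = (fun y : ℝ => ((435637 : ℝ) / 262144) * tau' ((y + 1) / 2)) := by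
    funext y; exact gp_eq_profile y
  rw [ea, s_real, eg] at h
  exact h

/-- The background `τ′` is an admissible profile of the cited theorem (`∫₀¹ τ′ = −1`, `τ′ ∈ L¹ ∩ L²`: it is a polynomial). -/
theorem profile_tau' : Profile tau' where
  integrable := (tauRB_continuous _ _ _).intervalIntegrable _ _
  sq_integrable := ((tauRB_continuous _ _ _).pow 2).intervalIntegrable _ _
  total := tauRB_total _ _ (rfl : phiR 0 = 0)

/-- The value of the cited bound at this background: `s∫₀¹τ′² − (s−1) = 1 + Σ_p φ̂_p²/((2p+1)s) = 871753553815459157/273640575184404480`. -/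
theorem bound_value : ((435637 : ℝ) / 262144) * (∫ z in (0 : ℝ)..1, tau' z ^ 2) - (((435637 : ℝ) / 262144) - 1)
    = (871753553815459157 : ℝ) / 273640575184404480 := by
  unfold tau'
  rw [rb_bound_value (by norm_num) 6 (rfl : phiR 0 = 0)]
  simp only [sum_range_succ, sum_range_zero, zero_add, phiR]
  norm_num [ghat1, ghat2, ghat3, ghat4, ghat5, ghat6]

/-- **ROW RB-N1′ from the cited theorem alone**: for every quantity `Nu` obeying the affine background-method reduction in mode form
(`SpectralReduction`), `Nu(10⁴) ≤ 871753553815459157/273640575184404480` (every Pr, every horizontal period / lattice, d = 2, 3). -/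
theorem nusselt_bound_of_spectralReduction (Nu : ℝ → ℝ) (h : SpectralReduction Nu) :
    Nu 10000 ≤ (871753553815459157 : ℝ) / 273640575184404480 := by
  have hb := h 10000 ((435637 : ℝ) / 262144) tau' (by norm_num) (by norm_num) profile_tau' spectralConstraint_holds
  rw [bound_value] at hb
  exact hb

/-- Decimal form (outward rounding, as printed in CERTIFIED.md / main.md Table 1): `Nu(10⁴) ≤ 3.1857613`. -/
theorem nusselt_bound_decimal_of_spectralReduction (Nu : ℝ → ℝ) (h : SpectralReduction Nu) : Nu 10000 ≤ (3.1857613 : ℝ) := by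
  have hb := nusselt_bound_of_spectralReduction Nu h
  have hd : (871753553815459157 : ℝ) / 273640575184404480 ≤ (3.1857613 : ℝ) := by norm_num
  linarith

end Summit.NavierStokesRegularity.TurbBounds.Results.N1prime

end
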